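import Summits.BirchSwinnertonDyer.BirchSwinnertonDyer.Theorems.CumulativeHeegnerLeopoldtCumulativeHeegnerInclusionAtThreeLayerControl
import Summits.BirchSwinnertonDyer.Rank1Residual.O5.HeegnerLogTransportThreeResidualEngine
import Literature.NumberTheory.EllipticCurves.FineSelmerTorsionCoefficientsFiniteProofs
import Literature.NumberTheory.EllipticCurves.FineSelmerCoefficientMapProofs
import Literature.NumberTheory.EllipticCurves.IwasawaSelmerProofs
import Literature.NumberTheory.EllipticCurves.SelmerCorankAssembly
import HarnessLib

/-!
# Route UniversalToricDescent — the mod-`p` Selmer classes of a LAYER inject into the `p`-torsion Γ_n-invariants of `Sel_{p^∞}(E/K_∞)`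
# (brick 2 of the port stub `stub_residualLinkMult`, line `beta-road` v5 on crux `TwinAlgMuZeroAtThree`, stmt-BirchSwinnertonDyer-24737)

Lead prover bsd-wall-utd-p1 g23 (`--supports stmt-BirchSwinnertonDyer-24737`). Γ_K-world only. For an elliptic curve `E = W/K` over a
number field, a prime `p`, a `ℤ_p`-extension `κ` with layers `Gal(K̄/K_n) = κ.layerSubgroup n`, and ANY `γ ∈ Γ_K`: if `E(K_∞)[p] = 0`
(«no non-zero point of `E[p^∞]` is fixed by `ker κ`», e.g. `ρ̄_p` onto: `…TowerTorsion.fixedPoints_kerSubgroup_geomPrimaryTorsion_baseChange_eq_bot_of_surjective`), the map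
`y ↦ res_{K_n→K_∞}((E[p] ↪ E[p^∞])_* y)` INJECTS the classes `y ∈ H¹(Γ_{K_n}, E[p])` whose image lies in `Sel_{p^∞}(E/K_n)`
(`W.selmerLayer κ n`) into `{s ∈ Sel_{p^∞}(E/K_∞) : p·s = 0, conj_{γ^{pⁿ}} s = s}`:

* **`natCard_layerSelmerTorsion_le`** — the injection and the resulting
  inequality of cardinalities (with finiteness transferred from the right-hand side).

This converts the research stub K2_res («`#{s ∈ Sel_{3^∞}(E′/K_∞) : 3s = 0, γ^{3ⁿ}s = s} ≤ 3^{3ⁿ+C}`») into the layer-`n` bound the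
finite-level two-sided link consumes. Inputs (tree): `map_layerToInfty_selmerLayer_le_holds` (Selmer restricts to Selmer),
`FineSelmerCoefficientMap.p_smul_torsionToPrimaryH1Sub_eq_zero`, `…CumulativeHeegnerInclusionAtThreeLayerControl.conjH1_pow_resOfLe_layer`
(`γ^{pⁿ} ∈ Γ_{K_n}` acts trivially) and `.resOfLe_layer_injective_of_fixedPoints`, `O5.HeegnerLogTransport.torsionToPrimaryH1Sub_injective_of_fixed`.
THEOREMS ONLY (no definition, no named fact, no `sorry`). BSD is not advanced by this file.
References: [GreenbergLNM1716] §1 Thm. 1.2, §3 Lemma 3.1; [GreenbergVatsal2000] §2 Prop. (2.8) («`Sel(E[p]) = Sel(E[p^∞])[p]` when `E(ℚ_∞)[p] = 0`»).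
-/

set_option linter.dupNamespace false
set_option autoImplicit false

noncomputable section

open scoped Classical

namespace Summit.BirchSwinnertonDyer.BirchSwinnertonDyer.Theorems.UniversalToricDescentLayerSelmerInjection

open Field Literature.NumberTheory.EllipticCurves WeierstrassCurve
open Summit.BirchSwinnertonDyer.BirchSwinnertonDyer.Theorems.CumulativeHeegnerInclusionAtThreeLayerControl

variable {K : Type} [Field K] [NumberField K] (W : WeierstrassCurve K) {p : ℕ} [hp : Fact p.Prime]
  (κ : ZpExtension K p)

/-- **The layer injection.** Under `E(K_∞)[p] = 0`, `y ↦ res_{K_n→K_∞}((E[p] ↪ E[p^∞])_* y)` maps `{y ∈ H¹(Γ_{K_n}, E[p]) : (ι y) ∈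
Sel_{p^∞}(E/K_n)}` injectively into `{s ∈ Sel_{p^∞}(E/K_∞) : p·s = 0, conj_{γ^{pⁿ}} s = s}`; hence if the latter is finite so is the
former, with no more elements. [cite: GreenbergLNM1716, §1 Thm. 1.2 and §3 Lemma 3.1] [cite: GreenbergVatsal2000, §2 Prop. (2.8)] -/
theorem natCard_layerSelmerTorsion_le (n : ℕ) (γ : absoluteGaloisGroup K)
    (h0 : ∀ m : W.geomPrimaryTorsion p, (∀ σ ∈ κ.kerSubgroup, σ • m = m) → m = 0)
    (hfin : Set.Finite {s : W.selmerInfty κ |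
      p • s = 0 ∧ W.conjH1 p κ.kerSubgroup (γ ^ p ^ n) (s : W.subgroupH1 p κ.kerSubgroup) = s}) :
    Set.Finite {y : subgroupH1 (κ.layerSubgroup n) (W.geomTorsion (p : ℤ)) |
        W.torsionToPrimaryH1Sub p (κ.layerSubgroup n) y ∈ W.selmerLayer κ n} ∧
      Nat.card {y : subgroupH1 (κ.layerSubgroup n) (W.geomTorsion (p : ℤ)) |
          W.torsionToPrimaryH1Sub p (κ.layerSubgroup n) y ∈ W.selmerLayer κ n} ≤
        Nat.card {s : W.selmerInfty κ |
          p • s = 0 ∧ W.conjH1 p κ.kerSubgroup (γ ^ p ^ n) (s : W.subgroupH1 p κ.kerSubgroup) = s} := by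
  -- notation
  set ι := W.torsionToPrimaryH1Sub p (κ.layerSubgroup n) with hι
  set res := W.resOfLe p (κ.kerSubgroup_le_layerSubgroup n) with hres
  -- the map
  have hmem : ∀ y : subgroupH1 (κ.layerSubgroup n) (W.geomTorsion (p : ℤ)),
      ι y ∈ W.selmerLayer κ n → res (ι y) ∈ W.selmerInfty κ := fun y hy ↦
    W.map_layerToInfty_selmerLayer_le_holds κ n (AddSubgroup.mem_map_of_mem _ hy)
  let f : {y : subgroupH1 (κ.layerSubgroup n) (W.geomTorsion (p : ℤ)) | ι y ∈ W.selmerLayer κ n} →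
      {s : W.selmerInfty κ |
        p • s = 0 ∧ W.conjH1 p κ.kerSubgroup (γ ^ p ^ n) (s : W.subgroupH1 p κ.kerSubgroup) = s} :=
    fun y ↦ ⟨⟨res (ι y), hmem y.1 y.2⟩, by
      refine ⟨Subtype.ext ?_, ?_⟩
      · show p • res (ι y) = 0
        rw [← map_nsmul, FineSelmerCoefficientMap.p_smul_torsionToPrimaryH1Sub_eq_zero, map_zero]
      · exact conjH1_pow_resOfLe_layer κ n γ (ι y)⟩
  -- injectivity: `ι` and `res` are injective under `E(K_∞)[p] = 0`
  have hι_inj : Function.Injective ι :=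
    Summit.BirchSwinnertonDyer.Rank1Residual.O5.HeegnerLogTransport.torsionToPrimaryH1Sub_injective_of_fixed
      W p (κ.layerSubgroup n)
      fun m hm _ ↦ h0 m (fun σ hσ ↦ hm σ (κ.kerSubgroup_le_layerSubgroup n hσ))
  have hres_inj : Function.Injective res :=
    resOfLe_layer_injective_of_fixedPoints κ n (W.continuous_smul_geomPrimaryTorsion p) h0
  have hf : Function.Injective f := by
    intro y y' h
    have h1 : res (ι y) = res (ι y') := congrArg (fun s ↦ ((s.1 : W.selmerInfty κ) : W.subgroupH1 p κ.kerSubgroup)) h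
    exact Subtype.ext (hι_inj (hres_inj h1))
  haveI : Finite {s : W.selmerInfty κ |
      p • s = 0 ∧ W.conjH1 p κ.kerSubgroup (γ ^ p ^ n) (s : W.subgroupH1 p κ.kerSubgroup) = s} := hfin.to_subtype
  haveI : Finite {y : subgroupH1 (κ.layerSubgroup n) (W.geomTorsion (p : ℤ)) | ι y ∈ W.selmerLayer κ n} :=
    Finite.of_injective f hf
  exact ⟨Set.toFinite _, Nat.card_le_card_of_injective f hf⟩

end Summit.BirchSwinnertonDyer.BirchSwinnertonDyer.Theorems.UniversalToricDescentLayerSelmerInjection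

end
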